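import Mathlib
import Literature.Computability.AlgebraicComplexity.StandardFamilies
import Literature.Computability.AlgebraicComplexity.DeterminantalConormalBound
import Literature.RingTheory.Nullstellensatz.SkodaBrownawellDegreeBound
import Summits.ValiantsHypothesis.ValiantsHypothesis.Theses.RefutationDegree
import Summits.ValiantsHypothesis.ValiantsHypothesis.Theorems.RefutationDegreeDefs
import Summits.ValiantsHypothesis.ValiantsHypothesis.Theorems.RefutationDegreeRefutationBarrierConverse
import Summits.ValiantsHypothesis.ValiantsHypothesis.Theorems.RefutationDegreeRefutationBarrierStubBorderSections
import Summits.ValiantsHypothesis.ValiantsHypothesis.Theorems.RefutationDegreeRefutationBarrierStubPolarPersistenceCoeff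
import Summits.ValiantsHypothesis.ValiantsHypothesis.Theorems.RefutationDegreeRefutationBarrierStubTwistNondegenerate
import Summits.ValiantsHypothesis.ValiantsHypothesis.Theorems.DetQPDetqpSuperquadraticStubPolarCountND
import Summits.ValiantsHypothesis.ValiantsHypothesis.Theorems.DetQPDetqpSuperquadraticStubPolarPersistenceND

/-!
# Crux `RefutationBarrier` (stmt-ValiantsHypothesis-5642), line `Sketch_ideator5` (lead c2):
# border transfer of sectional-class witnesses (unconditional), and the conditional refutation of the crux

Main result (`notInBorder_of_sectionalWitness`): if `per_n` (`n ≤ m`) lies in the AFFINE BORDER at size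
`m` (`InBorder n m`: a coefficientwise limit of determinants of size-`m` affine pencils), then no linear
section `per_n ∘ L` in `N ≥ 3` variables has, at any pencil/chart datum `(a, b, c)`, more than
Sheshadri's two-kernel Bézout number `B(m, N)` (`conormalBezout`) NON-DEGENERATE polar points
(`polarSet` points at which the bordered-Hessian Jacobian of the square polar system is invertible).
This is the permanent's analogue of the border transfer of arXiv:2606.13628 §§4–7 (conormal
specialisation), obtained here by elementary analysis: slice the homogenising variable by the chart
covector `c` (the twist `ℓ^{m-n}`, `ℓ = Σ cᵢ yᵢ`, equals `1` on every polar point — `stub_twistNondegenerate`),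
approximate `ℓ^{m-n}·(per_n ∘ L)` coefficientwise by degree-`m` forms with size-`m` determinantal
representations (`stub_borderSections`), continue the witnesses to non-degenerate polar points of the
approximants (`stub_polarPersistenceCoeff`, implicit function theorem in the coefficients), move the
datum off Sheshadri's bad hypersurface (`stub_polarPersistenceND`) and count (`stub_polarCountND`, the
tree's non-degenerate form of arXiv:2606.13628 Thm 3(i), on top of the PROVED
`Sheshadri2026_polarCount_le_holds`).

Consequences: `io_notInBorder_of_sectionalWitnessQuad` (witnesses beating `B(⌊n²/2⌋+1, N)` infinitely
often ⟹ `per_n` off the critical affine border infinitely often — a border lower bound LMR13 + 1) and,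
through the landed converse `not_refutationBarrier_of_io_notInBorder` (Skoda–Brownawell as named
hypothesis), `not_refutationBarrier_of_sectionalWitnessQuad`: the crux is FALSE modulo SB and the
line's research statement `stub_sectionalWitnessQuad` (taken as a hypothesis; nothing unproved is
asserted).  All other inputs are tree theorems.
-/

set_option linter.dupNamespace false

noncomputable section

namespace Summit.ValiantsHypothesis.ValiantsHypothesis.Theorems.RefutationDegree

open scoped BigOperators
open Filter Topology MvPolynomial Matrix
open Literature.Computability.AlgebraicComplexity (perPoly perPoly_isHomogeneous HasDetRepr polarSet
  conormalBezout)
open Literature.RingTheory.Nullstellensatz (skodaBrownawellDegreeBound)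
open Summit.ValiantsHypothesis.ValiantsHypothesis.Theses.RefutationDegree
open Summit.ValiantsHypothesis.ValiantsHypothesis.Theorems.DetQPDetqpSuperquadratic
  (stub_polarCountND stub_polarPersistenceND)

/-- **Border transfer of sectional-class witnesses.**  If `per_n` (`n ≤ m`) is in the affine border
at size `m`, then no linear section `per_n ∘ L` (`L` a tuple of linear forms in `N ≥ 3` variables)
has, at any pencil/chart datum `(a, b, c)`, a finite set of more than `B(m, N)` non-degenerate polar
points.  Proof: twist by `ℓ^{m-n}` with `ℓ = Σ cᵢyᵢ` (`= 1` on the chart, `stub_twistNondegenerate`),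
approximate by determinantal degree-`m` forms (`stub_borderSections`), continue the witnesses
(`stub_polarPersistenceCoeff`), move off Sheshadri's hypersurface (`stub_polarPersistenceND`) and
count (`stub_polarCountND`). -/
theorem notInBorder_of_sectionalWitness {n m N : ℕ} (hnm : n ≤ m) (hN : 3 ≤ N)
    (L : Fin n × Fin n → MvPolynomial (Fin N) ℂ) (hL : ∀ e, (L e).IsHomogeneous 1)
    (a b c : Fin N → ℂ) (F : Finset (Fin N → ℂ))
    (hF : ∀ x ∈ F, x ∈ polarSet (aeval L (perPoly (Fin n) ℂ)) a b c ∧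
      (Matrix.fromBlocks
        (Matrix.of fun i j : Fin N => eval x (pderiv i (pderiv j (aeval L (perPoly (Fin n) ℂ)))))
        (Matrix.of fun (i : Fin N) (l : Fin 2) => ![a i, b i] l)
        (Matrix.of fun (l : Fin 2) (j : Fin N) =>
          ![eval x (pderiv j (aeval L (perPoly (Fin n) ℂ))), c j] l)
        (0 : Matrix (Fin 2) (Fin 2) ℂ)).det ≠ 0)
    (hcard : conormalBezout m N < F.card) : ¬ InBorder n m := by
  classical
  intro hB
  -- the twist `ℓ^{m-n}`, `ℓ = Σ cᵢ yᵢ`, equals `1` on the chart `c·x = 1`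
  set ℓ : MvPolynomial (Fin N) ℂ := ∑ i, C (c i) * X i with hℓ
  set g : MvPolynomial (Fin N) ℂ := ℓ ^ (m - n) * aeval L (perPoly (Fin n) ℂ) with hg
  have hℓx : ∀ x ∈ F, eval x (ℓ ^ (m - n)) ≠ 0 := by
    intro x hx
    obtain ⟨-, -, -, hchart⟩ := (hF x hx).1
    have h1 : eval x ℓ = 1 := by
      simp only [hℓ, map_sum, map_mul, eval_C, eval_X]
      exact hchart
    rw [map_pow, h1, one_pow]
    exact one_ne_zero
  -- `F` is a set of non-degenerate polar points of `g`
  have hFg : ∀ x ∈ F, x ∈ polarSet g a b c ∧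
      (Matrix.fromBlocks
        (Matrix.of fun i j : Fin N => eval x (pderiv i (pderiv j g)))
        (Matrix.of fun (i : Fin N) (l : Fin 2) => ![a i, b i] l)
        (Matrix.of fun (l : Fin 2) (j : Fin N) => ![eval x (pderiv j g), c j] l)
        (0 : Matrix (Fin 2) (Fin 2) ℂ)).det ≠ 0 := fun x hx =>
    stub_twistNondegenerate _ _ a b c x (hF x hx).1 (hF x hx).2 (hℓx x hx)
  -- border sections and their degrees
  obtain ⟨G, hG, hconv⟩ := stub_borderSections hnm hB L hL c
  have hdeg : ∀ j, (G j).totalDegree ≤ m := fun j => (hG j).2.totalDegree_le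
  -- persistence in the coefficients: some `G_j` has `≥ |F|` non-degenerate polar points
  obtain ⟨j, F', hFF', hF'⟩ := (stub_polarPersistenceCoeff g a b c F hFg G hdeg hconv).exists
  -- Sheshadri's bound for non-degenerate polar points of `G_j` off a hypersurface of data
  obtain ⟨Φ, hΦ0, hΦ⟩ := stub_polarCountND hN (G j) m m (hG j).2 (hG j).1
  -- persistence in the data: move off `Φ = 0` keeping `≥ |F'|` non-degenerate points
  obtain ⟨u, hu, F'', hF'F'', hF''⟩ := stub_polarPersistenceND (G j) a b c F' hF' Φ hΦ0
  have hcount := hΦ u hu F'' hF''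
  omega

/-- **Infinitely many witnesses beating `B(⌊n²/2⌋+1, N)` put `per_n` off the critical affine border
infinitely often** (a border lower bound `\overline{dc}_aff(per_n) ≥ ⌊n²/2⌋ + 2` for those `n`,
LMR13 + 1), using `n ≤ ⌊n²/2⌋ + 1` (`le_quadSize`). -/
theorem io_notInBorder_of_sectionalWitnessQuad
    (hW : ∀ n₀ : ℕ, ∃ n ≥ n₀, ∃ N : ℕ, 3 ≤ N ∧
      ∃ L : Fin n × Fin n → MvPolynomial (Fin N) ℂ, (∀ e, (L e).IsHomogeneous 1) ∧
        ∃ (a b c : Fin N → ℂ) (F : Finset (Fin N → ℂ)),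
          (∀ x ∈ F, x ∈ polarSet (aeval L (perPoly (Fin n) ℂ)) a b c ∧
            (Matrix.fromBlocks
              (Matrix.of fun i j : Fin N =>
                eval x (pderiv i (pderiv j (aeval L (perPoly (Fin n) ℂ)))))
              (Matrix.of fun (i : Fin N) (l : Fin 2) => ![a i, b i] l)
              (Matrix.of fun (l : Fin 2) (j : Fin N) =>
                ![eval x (pderiv j (aeval L (perPoly (Fin n) ℂ))), c j] l)
              (0 : Matrix (Fin 2) (Fin 2) ℂ)).det ≠ 0) ∧
          conormalBezout (n ^ 2 / 2 + 1) N < F.card) :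
    ∀ n₀ : ℕ, ∃ n ≥ n₀, ¬ InBorder n (n ^ 2 / 2 + 1) := by
  intro n₀
  obtain ⟨n, hn, N, hN, L, hL, a, b, c, F, hF, hcard⟩ := hW n₀
  exact ⟨n, hn, notInBorder_of_sectionalWitness (le_quadSize n) hN L hL a b c F hF hcard⟩

/-- **Conditional refutation of the crux through sectional classes.**  Modulo the named fact
`skodaBrownawellDegreeBound` (Skoda 1972 / Brownawell 1987) and the line's research statement
(hypothesis `hW`: for infinitely many `n` some linear section of `per_n` in `N ≥ 3` variables has a
datum with more than `B(⌊n²/2⌋+1, N)` non-degenerate polar points — the registered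
`stub_sectionalWitnessQuad` of this crux, verbatim), `RefutationBarrier` is FALSE: the witnesses put
`per_n` off the critical affine border infinitely often (`io_notInBorder_of_sectionalWitnessQuad`),
and the landed converse `not_refutationBarrier_of_io_notInBorder` does the rest. -/
theorem not_refutationBarrier_of_sectionalWitnessQuad
    (hSB : ∀ n m : ℕ, skodaBrownawellDegreeBound (σ := Unk n m) (ι := (Fin n × Fin n) →₀ ℕ))
    (hW : ∀ n₀ : ℕ, ∃ n ≥ n₀, ∃ N : ℕ, 3 ≤ N ∧
      ∃ L : Fin n × Fin n → MvPolynomial (Fin N) ℂ, (∀ e, (L e).IsHomogeneous 1) ∧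
        ∃ (a b c : Fin N → ℂ) (F : Finset (Fin N → ℂ)),
          (∀ x ∈ F, x ∈ polarSet (aeval L (perPoly (Fin n) ℂ)) a b c ∧
            (Matrix.fromBlocks
              (Matrix.of fun i j : Fin N =>
                eval x (pderiv i (pderiv j (aeval L (perPoly (Fin n) ℂ)))))
              (Matrix.of fun (i : Fin N) (l : Fin 2) => ![a i, b i] l)
              (Matrix.of fun (l : Fin 2) (j : Fin N) =>
                ![eval x (pderiv j (aeval L (perPoly (Fin n) ℂ))), c j] l)
              (0 : Matrix (Fin 2) (Fin 2) ℂ)).det ≠ 0) ∧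
          conormalBezout (n ^ 2 / 2 + 1) N < F.card) :
    ¬ RefutationBarrier :=
  not_refutationBarrier_of_io_notInBorder hSB (io_notInBorder_of_sectionalWitnessQuad hW)

end Summit.ValiantsHypothesis.ValiantsHypothesis.Theorems.RefutationDegree

end
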